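/-
Copyright (c) 2026 the pub-hodgecm-mathlib formalisation cell (harness21).  Prover seat hodgecm-mathlib-K2E1-p11 (g3), Track B ∕ K2-LIT, h413 = `stmt-HodgeConjecture-24833`,
R90-TF S8 «ContSpec-n½» (S8 dealer R90-CS-plan (g2) S8-R36 DEAL BY NAME F3, 2026-09-04T22:16:44Z): the G-SIDE TWIN of ★ p862226 `R90S8ResHTransportOfQuasiSplit` (K2E1-p15; R90-CS-audit1
(g2)'s J-S8-Wform-1 seam) — the TRANSPORT from the PRINT currency `quasiSplit L⁺ L c 3` to FILE B's literal `Φ₃` bytes for sockets #2 ∕ #3 ∕ #2♯.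
-/
import Summits.HodgeConjecture.HodgeConjecture.Theorems.R90S8ResidualDefs                  -- ★ D-S8-2′ `IsPiN` (+ ★ `cmResidualSubspaceR`, `cmParabolicDataR`, `flagUnipotentRadical`, D6 `CMLocalAPacket` ∕ `IsXiLocalFamily` ∕ `LocalConstituentsIn`)
import Summits.HodgeConjecture.HodgeConjecture.Theorems.K2E1HeisenbergRadicalCocompactU3   -- ★ `upperUnitriangular_eq_flagUnipotentRadical_three` (the Heisenberg radical of record IS the upper unitriangular group)
import Summits.HodgeConjecture.HodgeConjecture.Theorems.K2E1HeckeLHalfNeZeroDefs           -- ★ `LHalfNeZero` (central-value clause of #3 ∕ #2♯)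
import Literature.NumberTheory.Automorphic.UnitaryGroupGenericity                          -- ★ `adelicUnipotent`, `quasiSplit`
import Literature.NumberTheory.Automorphic.UnitaryGroupQuasiSplitCMDatum                   -- ★ `UnitaryGroup.cmConj_antidiagonal_transpose`, `quasiSplit_eq_cmDatum` (`rfl`), `StdForm.over_antidiagonal_eq`
import HarnessLib

/-!
# S8 #2-road — `R90S8ResGTransportOfQuasiSplitU3`: the W-FORM SEAM ON THE `G` SIDE — from statements about `L²_res(U_{L/L⁺}(3))` on Mok's spelling
# `quasiSplit L⁺ L c 3 = U((antidiagonal 3).over L)` (where the E1 Eisenstein∕scattering estate and the LAYER 1∕2 payers live) to FILE B's FROZEN bytes on the literal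
# `Φ₃ = (i,j) ↦ [i+j+1 = 3]` (`UnitaryGroup.cmDatum L 3 (qsForm L)`, `cmResidualSubspaceR L 3`, `IsPiN`) — sockets #2, #3, #2♯ of `Lines/R90_S8_ResidualSpectrumU3B.lean` ED. 4

Track B ∕ K2-LIT, crux h413 = `stmt-HodgeConjecture-24833`, route of record `HCCMUnconditional`; cell `hodgecm-mathlib`, R90-TF S8; spec = R90-C14-p02 (g0) `R90/S8/CENSUS-sock2-chain.R90-C14-p02-g0.md` (a)+(c) F3.
THEOREMS ONLY (no `def`, no `instance`, no `notation`, no named-fact hypothesis, no `sorry`; default heartbeats); lane `--supports stmt-HodgeConjecture-24833 --as helper`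
(count-neutral).  CLOSES NO SOCKET: each quasiSplit-side statement enters as an explicit ∀-hypothesis (the letter-free G-PRINT — F1∕F2 + (HEAD₃)(D₃)(E_blk,₃)(N_blk,₃)(L₃) +
the middle-residue socket, none available today); B ED. 5 then pays #2 ∕ #3 ∕ #2♯ by `exact resG_…_of_quasiSplit ‹that›` instead of an in-socket transport.

THE SEAM ([folklore]; device = ★ p862226's two-step `subst`, itself ★ p855771 §2).  `quasiSplit L⁺ L c 3 = cmDatum L 3 ((antidiagonal 3).over L)` is `rfl` (★
`UnitaryGroup.quasiSplit_eq_cmDatum`), but B's `cmDatum L 3 (qsForm L)` carries the LITERAL `Matrix.of`, equal to `(antidiagonal 3).over L` only PROPOSITIONALLY (★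
`antidiagOne_eq_over`, ★ `StdForm.over_antidiagonal_eq`), and `cmResidualSubspaceR ∕ cmParabolicDataR ∕ IsPiN` are typed at the literal form — so no `rw` on a socket goal is
motive-correct.  Step 1 (`…_of_eq`): state the quasiSplit conclusion for ANY form `J` with `hJ : (antidiagonal 3).over L = J`, hermitian∕unit witnesses `hJh hJu` as
binders, the ONE radical written `J`-generically as the pull-back of ★ `flagUnipotentRadical 3 1` (B's radical currency, ★ `cmUnipotentRadicalR L 3 1`), and «`π_v = πⁿ(ξ_v)`
∀ finite `v`» spelled as ★ `IsPiN`'s body at `J` (★ D6 `CMLocalAPacket L J v`, `ξ.IsXiLocalFamily hJh hJu μω hμu`, `LocalConstituentsIn`, the Haar-binder «¬ square-integrable»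
clause); `subst hJ`, and ★ `upperUnitriangular_eq_flagUnipotentRadical_three` identifies the radical with the Heisenberg `adelicUnipotent … 3` (proof-irrelevance takes care of
`hJh hJu` versus the print-side witnesses ★ `UnitaryGroup.cmConj_antidiagonal_transpose`, ★ `StdForm.isUnit_over`).  Step 2 (`…_of_quasiSplit`): instantiate at the literal
`Φ₃` with ★ `antidiagOne_eq_over`, ★ `antidiagOne_isHermitian`, ★ `isUnit_antidiagOne_det`, `𝔓 := cmParabolicDataR L 3` (index `{k ∕∕ 1 ≤ k ∧ 2k ≤ 3} = {1}`, its one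
radical is `cmUnipotentRadicalR L 3 1` by `rfl`), the `cmDatum → adelicGroupData` instance ascription — the conclusions are B's bytes VERBATIM (`IsPiN` unfolds by `rfl`).
§1 **`resG_classification_of_eq`** ∕ **`resG_classification_of_quasiSplit`** — #2 `sock_S8_res_classification` (B ED. 4 :205–:214) · §2 **`resG_piN_occurs_of_eq`** ∕
**`resG_piN_occurs_of_quasiSplit`** — #3 `sock_S8_res_piN_occurs` (:409–:417) · §3 **`resG_classification_sharp_of_eq`** ∕ **`resG_classification_sharp_of_quasiSplit`** — #2♯ (:433–:442).
PRINT: [Rogawski1990, §13.9 p. 229 (i)–(ii)] (residual spectrum of `U(2,1)`); [MoeglinWaldspurger1995, I.2.18]; the form `Φ_N` of [Mok2014, §1 Notation p. 5]; radicals [BorelJacquet1979, §4.4].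
HONEST LABEL: HC_CM is proved only modulo the 7 printed citations (2 remaining named inputs: hLiu418 = `stmt-HodgeConjecture-24832`, h413 = `stmt-HodgeConjecture-24833`) until rung 0
closes; REL ≠ ★ ≠ BUILT; no named fact, closes no socket (#2 ∕ #3 ∕ #2♯ stay OPEN: XL, Langlands' `L²`-theory for `U(2,1)` + the middle residue's local identification); count-neutral.
-/

set_option autoImplicit false
set_option linter.dupNamespace false  -- the mandated namespace `…HodgeConjecture.HodgeConjecture.R90.S8` (LEAD #1 L1) repeats the summit's segment

noncomputable section

open MeasureTheory NumberField IsDedekindDomain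
open scoped Matrix
open Literature.NumberTheory.GaloisRepresentations Literature.NumberTheory.Automorphic.Arthur2013.Leaves.TECR
open Literature.NumberTheory.Automorphic Literature.NumberTheory.Automorphic.UnitaryGroup Literature.NumberTheory.Rogawski1990
open Summit.HodgeConjecture.HodgeConjecture.Cruxes.H413.K2E1CuspidalSpectrumUnitary
open Summit.HodgeConjecture.HodgeConjecture.Cruxes.H413.R90S8ResidualDefs (IsPiN)
open Summit.HodgeConjecture.HodgeConjecture.Cruxes.H413.K2E1HeckeLHalfNeZeroDefs (LHalfNeZero)
open Summit.HodgeConjecture.HodgeConjecture.Cruxes.H413.K2E1HeisenbergRadicalCocompactU3 (upperUnitriangular_eq_flagUnipotentRadical_three)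

namespace Summit.HodgeConjecture.HodgeConjecture.R90.S8

/-! ## §1 Socket #2 `sock_S8_res_classification` — the print-IMPLIED classification [§13.9 p. 229 (i)–(ii)] -/

/-- **Step 1 of the seam for #2** (`J`-generic): if the classification «every irreducible constituent `P` of `L²_res(U_{L/L⁺}(3), 𝔓)` (`𝔓`'s radicals `= N(𝔸)`, the Heisenberg
radical ★ `adelicUnipotent … 3`) is one-dimensional or has `π_v = πⁿ(ξ_v)` at every finite `v` for some one-dimensional automorphic `ξ` of `H`» holds on Mok's `quasiSplit L⁺ L c 3`,
then it holds on `U(J)` for ANY form `J` with `(antidiagonal 3).over L = J` (witnesses `hJh hJu`; radicals = pull-back of ★ `flagUnipotentRadical 3 1`; «`π_v = πⁿ(ξ_v)` ∀ `v`» =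
★ `IsPiN`'s body at `J`) — by `subst` and ★ `upperUnitriangular_eq_flagUnipotentRadical_three`.
[cite: Rogawski1990, §13.9 p. 229 (i)–(ii)] [cite: MoeglinWaldspurger1995, I.2.18] -/
theorem resG_classification_of_eq {L : Type} [Field L] [NumberField L] [IsCMField L]
    (H : ∀ (μ : Measure (quasiSplit (↥(maximalRealSubfield L)) L (IsCMField.complexConj L) 3).automorphicQuotient)
      [(quasiSplit (↥(maximalRealSubfield L)) L (IsCMField.complexConj L) 3).IsAutomorphicMeasure μ]
      (𝔓 : (quasiSplit (↥(maximalRealSubfield L)) L (IsCMField.complexConj L) 3).ParabolicUnipotentData)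
      (_ : ∀ j : 𝔓.ι, 𝔓.radical j = adelicUnipotent (↥(maximalRealSubfield L)) L (IsCMField.complexConj L) 3)
      (μω : HeckeCharacter L) (hμu : μω.IsUnitary),
      (∀ x : Literature.NumberTheory.GaloisRepresentations.ideleGroup ↥(maximalRealSubfield L),
        μω (AdeleRing.ideleBaseChange (↥(maximalRealSubfield L)) L x) = quadraticHeckeCharCM L x) →
      ∀ (P : DiscreteAutomorphicRep (quasiSplit (↥(maximalRealSubfield L)) L (IsCMField.complexConj L) 3) μ),
        P.space ≤ residualSubspace (quasiSplit (↥(maximalRealSubfield L)) L (IsCMField.complexConj L) 3) μ 𝔓 →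
        P.IsOneDimensional ∨ ∃ ξ : OneDimAutRepH L,
          ∃ Pv : ∀ v : HeightOneSpectrum (𝓞 ↥(maximalRealSubfield L)), CMLocalAPacket L ((StdForm.antidiagonal 3).over L) v,
            ξ.IsXiLocalFamily (UnitaryGroup.cmConj_antidiagonal_transpose L 3)
                ((Matrix.isUnit_iff_isUnit_det _).mp (StdForm.isUnit_over (StdForm.antidiagonal 3) L)) μω hμu Pv ∧
            LocalConstituentsIn P Pv ∧
            ∀ v : HeightOneSpectrum (𝓞 ↥(maximalRealSubfield L)),
              (∀ w : PlacesOver L v, IsCMField.complexConj L • w.1 = w.1) →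
              ∀ c : IrrClass ((quasiSplit (↥(maximalRealSubfield L)) L (IsCMField.complexConj L) 3).Local v), c ∈ (Pv v).members →
                ¬ c.IsSupercuspidal ∧
                ∀ [MeasurableSpace ((quasiSplit (↥(maximalRealSubfield L)) L (IsCMField.complexConj L) 3).Local v ⧸
                      Subgroup.center ((quasiSplit (↥(maximalRealSubfield L)) L (IsCMField.complexConj L) 3).Local v))]
                  [BorelSpace ((quasiSplit (↥(maximalRealSubfield L)) L (IsCMField.complexConj L) 3).Local v ⧸
                      Subgroup.center ((quasiSplit (↥(maximalRealSubfield L)) L (IsCMField.complexConj L) 3).Local v))]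
                  (μZ : Measure ((quasiSplit (↥(maximalRealSubfield L)) L (IsCMField.complexConj L) 3).Local v ⧸
                      Subgroup.center ((quasiSplit (↥(maximalRealSubfield L)) L (IsCMField.complexConj L) 3).Local v)))
                  [μZ.IsHaarMeasure], ¬ c.IsSquareIntegrable μZ)
    {J : Matrix (Fin 3) (Fin 3) L} (hJ : (StdForm.antidiagonal 3).over L = J) (hJh : (J.map (cmConjRingHom L))ᵀ = J) (hJu : IsUnit J.det)
    (μ : Measure (adelicGroupData (↥(maximalRealSubfield L)) L (IsCMField.complexConj L) 3 J).automorphicQuotient)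
    [(adelicGroupData (↥(maximalRealSubfield L)) L (IsCMField.complexConj L) 3 J).IsAutomorphicMeasure μ]
    (𝔓 : (adelicGroupData (↥(maximalRealSubfield L)) L (IsCMField.complexConj L) 3 J).ParabolicUnipotentData)
    (h𝔓 : ∀ j : 𝔓.ι, 𝔓.radical j =
      (flagUnipotentRadical 3 1 (AdeleRing (𝓞 L) L)).comap (adelicVal (↥(maximalRealSubfield L)) L (IsCMField.complexConj L) 3 J))
    (μω : HeckeCharacter L) (hμu : μω.IsUnitary)
    (hμω : ∀ x : Literature.NumberTheory.GaloisRepresentations.ideleGroup ↥(maximalRealSubfield L),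
      μω (AdeleRing.ideleBaseChange (↥(maximalRealSubfield L)) L x) = quadraticHeckeCharCM L x)
    (P : DiscreteAutomorphicRep (adelicGroupData (↥(maximalRealSubfield L)) L (IsCMField.complexConj L) 3 J) μ)
    (hP : P.space ≤ residualSubspace (adelicGroupData (↥(maximalRealSubfield L)) L (IsCMField.complexConj L) 3 J) μ 𝔓) :
    P.IsOneDimensional ∨ ∃ ξ : OneDimAutRepH L,
      ∃ Pv : ∀ v : HeightOneSpectrum (𝓞 ↥(maximalRealSubfield L)), CMLocalAPacket L J v,
        ξ.IsXiLocalFamily hJh hJu μω hμu Pv ∧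
        LocalConstituentsIn P Pv ∧
        ∀ v : HeightOneSpectrum (𝓞 ↥(maximalRealSubfield L)),
          (∀ w : PlacesOver L v, IsCMField.complexConj L • w.1 = w.1) →
          ∀ c : IrrClass ((UnitaryGroup.cmDatum L 3 J).Local v), c ∈ (Pv v).members →
            ¬ c.IsSupercuspidal ∧
            ∀ [MeasurableSpace ((UnitaryGroup.cmDatum L 3 J).Local v ⧸ Subgroup.center ((UnitaryGroup.cmDatum L 3 J).Local v))]
              [BorelSpace ((UnitaryGroup.cmDatum L 3 J).Local v ⧸ Subgroup.center ((UnitaryGroup.cmDatum L 3 J).Local v))]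
              (μZ : Measure ((UnitaryGroup.cmDatum L 3 J).Local v ⧸ Subgroup.center ((UnitaryGroup.cmDatum L 3 J).Local v)))
              [μZ.IsHaarMeasure], ¬ c.IsSquareIntegrable μZ := by
  subst hJ
  have h𝔓' : ∀ j : 𝔓.ι, 𝔓.radical j = adelicUnipotent (↥(maximalRealSubfield L)) L (IsCMField.complexConj L) 3 := fun j => by
    rw [h𝔓 j]
    show _ = (upperUnitriangular (Fin 3) (AdeleRing (𝓞 L) L)).comap _
    rw [upperUnitriangular_eq_flagUnipotentRadical_three]
  exact H μ 𝔓 h𝔓' μω hμu hμω P hP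

/-- **THE JUNCTION for #2 — the quasiSplit classification for every CM field yields socket #2's EXACT type** (`Lines/R90_S8_ResidualSpectrumU3B.lean` ED. 4 :205–:214,
literal `Φ₃ = qsForm L`, `cmResidualSubspaceR L 3`, `IsPiN`): Step 1 at `J := Φ₃` (★ `antidiagOne_eq_over`, ★ `antidiagOne_isHermitian`, ★ `isUnit_antidiagOne_det`), `𝔓 := cmParabolicDataR L 3`
(single radical, `rfl`), instance ascription `cmDatum → adelicGroupData`; `IsPiN` unfolds by `rfl`.  B ED. 5: `exact resG_classification_of_quasiSplit ‹G-PRINT›`. [cite: Rogawski1990, §13.9 p. 229 (i)–(ii)] -/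
theorem resG_classification_of_quasiSplit
    (H : ∀ (L : Type) [Field L] [NumberField L] [IsCMField L]
      (μ : Measure (quasiSplit (↥(maximalRealSubfield L)) L (IsCMField.complexConj L) 3).automorphicQuotient)
      [(quasiSplit (↥(maximalRealSubfield L)) L (IsCMField.complexConj L) 3).IsAutomorphicMeasure μ]
      (𝔓 : (quasiSplit (↥(maximalRealSubfield L)) L (IsCMField.complexConj L) 3).ParabolicUnipotentData)
      (_ : ∀ j : 𝔓.ι, 𝔓.radical j = adelicUnipotent (↥(maximalRealSubfield L)) L (IsCMField.complexConj L) 3)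
      (μω : HeckeCharacter L) (hμu : μω.IsUnitary),
      (∀ x : Literature.NumberTheory.GaloisRepresentations.ideleGroup ↥(maximalRealSubfield L),
        μω (AdeleRing.ideleBaseChange (↥(maximalRealSubfield L)) L x) = quadraticHeckeCharCM L x) →
      ∀ (P : DiscreteAutomorphicRep (quasiSplit (↥(maximalRealSubfield L)) L (IsCMField.complexConj L) 3) μ),
        P.space ≤ residualSubspace (quasiSplit (↥(maximalRealSubfield L)) L (IsCMField.complexConj L) 3) μ 𝔓 →
        P.IsOneDimensional ∨ ∃ ξ : OneDimAutRepH L,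
          ∃ Pv : ∀ v : HeightOneSpectrum (𝓞 ↥(maximalRealSubfield L)), CMLocalAPacket L ((StdForm.antidiagonal 3).over L) v,
            ξ.IsXiLocalFamily (UnitaryGroup.cmConj_antidiagonal_transpose L 3)
                ((Matrix.isUnit_iff_isUnit_det _).mp (StdForm.isUnit_over (StdForm.antidiagonal 3) L)) μω hμu Pv ∧
            LocalConstituentsIn P Pv ∧
            ∀ v : HeightOneSpectrum (𝓞 ↥(maximalRealSubfield L)),
              (∀ w : PlacesOver L v, IsCMField.complexConj L • w.1 = w.1) →
              ∀ c : IrrClass ((quasiSplit (↥(maximalRealSubfield L)) L (IsCMField.complexConj L) 3).Local v), c ∈ (Pv v).members →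
                ¬ c.IsSupercuspidal ∧
                ∀ [MeasurableSpace ((quasiSplit (↥(maximalRealSubfield L)) L (IsCMField.complexConj L) 3).Local v ⧸
                      Subgroup.center ((quasiSplit (↥(maximalRealSubfield L)) L (IsCMField.complexConj L) 3).Local v))]
                  [BorelSpace ((quasiSplit (↥(maximalRealSubfield L)) L (IsCMField.complexConj L) 3).Local v ⧸
                      Subgroup.center ((quasiSplit (↥(maximalRealSubfield L)) L (IsCMField.complexConj L) 3).Local v))]
                  (μZ : Measure ((quasiSplit (↥(maximalRealSubfield L)) L (IsCMField.complexConj L) 3).Local v ⧸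
                      Subgroup.center ((quasiSplit (↥(maximalRealSubfield L)) L (IsCMField.complexConj L) 3).Local v)))
                  [μZ.IsHaarMeasure], ¬ c.IsSquareIntegrable μZ) :
    ∀ (L : Type) [Field L] [NumberField L] [IsCMField L]
      (μ : Measure (UnitaryGroup.cmDatum L 3 (qsForm L)).automorphicQuotient) [(UnitaryGroup.cmDatum L 3 (qsForm L)).IsAutomorphicMeasure μ]
      (μω : HeckeCharacter L) (hμu : μω.IsUnitary),
      (∀ x : Literature.NumberTheory.GaloisRepresentations.ideleGroup ↥(maximalRealSubfield L),
        μω (AdeleRing.ideleBaseChange (↥(maximalRealSubfield L)) L x) = quadraticHeckeCharCM L x) →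
      ∀ (P : DiscreteAutomorphicRep (UnitaryGroup.cmDatum L 3 (qsForm L)) μ),
        P.space ≤ cmResidualSubspaceR L 3 μ →
        P.IsOneDimensional ∨ ∃ ξ : OneDimAutRepH L, IsPiN P μω hμu ξ := by
  intro L _ _ _ μ _ μω hμu hμω P hP
  haveI : (adelicGroupData (↥(maximalRealSubfield L)) L (IsCMField.complexConj L) 3
      (Matrix.of fun i j : Fin 3 => if i.val + j.val + 1 = 3 then (1 : L) else 0)).IsAutomorphicMeasure μ :=
    ‹(UnitaryGroup.cmDatum L 3 (qsForm L)).IsAutomorphicMeasure μ›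
  have hrad : ∀ j : (cmParabolicDataR L 3).ι, (cmParabolicDataR L 3).radical j =
      (flagUnipotentRadical 3 1 (AdeleRing (𝓞 L) L)).comap
        (adelicVal (↥(maximalRealSubfield L)) L (IsCMField.complexConj L) 3 (Matrix.of fun i j : Fin 3 => if i.val + j.val + 1 = 3 then (1 : L) else 0)) := by
    rintro ⟨k, hk1, hk2⟩
    have hk : k = 1 := by omega
    subst hk
    rfl
  exact resG_classification_of_eq (H L) (antidiagOne_eq_over L 3).symm (antidiagOne_isHermitian L 3) (isUnit_antidiagOne_det L 3) μ
    (cmParabolicDataR L 3) hrad μω hμu hμω P hP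

/-! ## §2 Socket #3 `sock_S8_res_piN_occurs` — `πⁿ(ξ)` OCCURS when `L(½, φ_ξ) ≠ 0` [§13.9 p. 229 (ii); Thm. 13.3.6 (a)] -/

/-- **Step 1 of the seam for #3** (`J`-generic): the quasiSplit-side existence «for `ξ` with `L(½, ξ.bcη⁻¹·μω) ≠ 0` (★ `LHalfNeZero`) there is an irreducible constituent `P` of
`L²_res(U_{L/L⁺}(3), 𝔓)` with `π_v = πⁿ(ξ_v)` at every finite `v`» transported to `U(J)` for any `J` with `(antidiagonal 3).over L = J` (same device as §1).
[cite: Rogawski1990, §13.9 p. 229 (ii)] [cite: Rogawski1990, Thm. 13.3.6 (a) p. 202] -/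
theorem resG_piN_occurs_of_eq {L : Type} [Field L] [NumberField L] [IsCMField L]
    (H : ∀ (μ : Measure (quasiSplit (↥(maximalRealSubfield L)) L (IsCMField.complexConj L) 3).automorphicQuotient)
      [(quasiSplit (↥(maximalRealSubfield L)) L (IsCMField.complexConj L) 3).IsAutomorphicMeasure μ]
      (𝔓 : (quasiSplit (↥(maximalRealSubfield L)) L (IsCMField.complexConj L) 3).ParabolicUnipotentData)
      (_ : ∀ j : 𝔓.ι, 𝔓.radical j = adelicUnipotent (↥(maximalRealSubfield L)) L (IsCMField.complexConj L) 3)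
      (μω : HeckeCharacter L) (hμu : μω.IsUnitary),
      (∀ x : Literature.NumberTheory.GaloisRepresentations.ideleGroup ↥(maximalRealSubfield L),
        μω (AdeleRing.ideleBaseChange (↥(maximalRealSubfield L)) L x) = quadraticHeckeCharCM L x) →
      ∀ (ξ : OneDimAutRepH L), LHalfNeZero (ξ.bcη⁻¹ * μω) →
        ∃ P : DiscreteAutomorphicRep (quasiSplit (↥(maximalRealSubfield L)) L (IsCMField.complexConj L) 3) μ,
          (∃ Pv : ∀ v : HeightOneSpectrum (𝓞 ↥(maximalRealSubfield L)), CMLocalAPacket L ((StdForm.antidiagonal 3).over L) v,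
            ξ.IsXiLocalFamily (UnitaryGroup.cmConj_antidiagonal_transpose L 3)
                ((Matrix.isUnit_iff_isUnit_det _).mp (StdForm.isUnit_over (StdForm.antidiagonal 3) L)) μω hμu Pv ∧
            LocalConstituentsIn P Pv ∧
            ∀ v : HeightOneSpectrum (𝓞 ↥(maximalRealSubfield L)),
              (∀ w : PlacesOver L v, IsCMField.complexConj L • w.1 = w.1) →
              ∀ c : IrrClass ((quasiSplit (↥(maximalRealSubfield L)) L (IsCMField.complexConj L) 3).Local v), c ∈ (Pv v).members →
                ¬ c.IsSupercuspidal ∧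
                ∀ [MeasurableSpace ((quasiSplit (↥(maximalRealSubfield L)) L (IsCMField.complexConj L) 3).Local v ⧸
                      Subgroup.center ((quasiSplit (↥(maximalRealSubfield L)) L (IsCMField.complexConj L) 3).Local v))]
                  [BorelSpace ((quasiSplit (↥(maximalRealSubfield L)) L (IsCMField.complexConj L) 3).Local v ⧸
                      Subgroup.center ((quasiSplit (↥(maximalRealSubfield L)) L (IsCMField.complexConj L) 3).Local v))]
                  (μZ : Measure ((quasiSplit (↥(maximalRealSubfield L)) L (IsCMField.complexConj L) 3).Local v ⧸
                      Subgroup.center ((quasiSplit (↥(maximalRealSubfield L)) L (IsCMField.complexConj L) 3).Local v)))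
                  [μZ.IsHaarMeasure], ¬ c.IsSquareIntegrable μZ) ∧
          P.space ≤ residualSubspace (quasiSplit (↥(maximalRealSubfield L)) L (IsCMField.complexConj L) 3) μ 𝔓)
    {J : Matrix (Fin 3) (Fin 3) L} (hJ : (StdForm.antidiagonal 3).over L = J) (hJh : (J.map (cmConjRingHom L))ᵀ = J) (hJu : IsUnit J.det)
    (μ : Measure (adelicGroupData (↥(maximalRealSubfield L)) L (IsCMField.complexConj L) 3 J).automorphicQuotient)
    [(adelicGroupData (↥(maximalRealSubfield L)) L (IsCMField.complexConj L) 3 J).IsAutomorphicMeasure μ]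
    (𝔓 : (adelicGroupData (↥(maximalRealSubfield L)) L (IsCMField.complexConj L) 3 J).ParabolicUnipotentData)
    (h𝔓 : ∀ j : 𝔓.ι, 𝔓.radical j =
      (flagUnipotentRadical 3 1 (AdeleRing (𝓞 L) L)).comap (adelicVal (↥(maximalRealSubfield L)) L (IsCMField.complexConj L) 3 J))
    (μω : HeckeCharacter L) (hμu : μω.IsUnitary)
    (hμω : ∀ x : Literature.NumberTheory.GaloisRepresentations.ideleGroup ↥(maximalRealSubfield L),
      μω (AdeleRing.ideleBaseChange (↥(maximalRealSubfield L)) L x) = quadraticHeckeCharCM L x)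
    (ξ : OneDimAutRepH L) (hL : LHalfNeZero (ξ.bcη⁻¹ * μω)) :
    ∃ P : DiscreteAutomorphicRep (adelicGroupData (↥(maximalRealSubfield L)) L (IsCMField.complexConj L) 3 J) μ,
      (∃ Pv : ∀ v : HeightOneSpectrum (𝓞 ↥(maximalRealSubfield L)), CMLocalAPacket L J v,
        ξ.IsXiLocalFamily hJh hJu μω hμu Pv ∧
        LocalConstituentsIn P Pv ∧
        ∀ v : HeightOneSpectrum (𝓞 ↥(maximalRealSubfield L)),
          (∀ w : PlacesOver L v, IsCMField.complexConj L • w.1 = w.1) →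
          ∀ c : IrrClass ((UnitaryGroup.cmDatum L 3 J).Local v), c ∈ (Pv v).members →
            ¬ c.IsSupercuspidal ∧
            ∀ [MeasurableSpace ((UnitaryGroup.cmDatum L 3 J).Local v ⧸ Subgroup.center ((UnitaryGroup.cmDatum L 3 J).Local v))]
              [BorelSpace ((UnitaryGroup.cmDatum L 3 J).Local v ⧸ Subgroup.center ((UnitaryGroup.cmDatum L 3 J).Local v))]
              (μZ : Measure ((UnitaryGroup.cmDatum L 3 J).Local v ⧸ Subgroup.center ((UnitaryGroup.cmDatum L 3 J).Local v)))
              [μZ.IsHaarMeasure], ¬ c.IsSquareIntegrable μZ) ∧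
      P.space ≤ residualSubspace (adelicGroupData (↥(maximalRealSubfield L)) L (IsCMField.complexConj L) 3 J) μ 𝔓 := by
  subst hJ
  have h𝔓' : ∀ j : 𝔓.ι, 𝔓.radical j = adelicUnipotent (↥(maximalRealSubfield L)) L (IsCMField.complexConj L) 3 := fun j => by
    rw [h𝔓 j]
    show _ = (upperUnitriangular (Fin 3) (AdeleRing (𝓞 L) L)).comap _
    rw [upperUnitriangular_eq_flagUnipotentRadical_three]
  exact H μ 𝔓 h𝔓' μω hμu hμω ξ hL

/-- **THE JUNCTION for #3 — the quasiSplit existence statement for every CM field yields socket #3's EXACT type** (B ED. 4 :409–:417: literal `Φ₃`, `IsPiN`, `cmResidualSubspaceR L 3`).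
B ED. 5 pays #3 by `exact resG_piN_occurs_of_quasiSplit ‹that›`. [cite: Rogawski1990, §13.9 p. 229 (ii)] [cite: Rogawski1990, Thm. 13.3.6 (a) p. 202] -/
theorem resG_piN_occurs_of_quasiSplit
    (H : ∀ (L : Type) [Field L] [NumberField L] [IsCMField L]
      (μ : Measure (quasiSplit (↥(maximalRealSubfield L)) L (IsCMField.complexConj L) 3).automorphicQuotient)
      [(quasiSplit (↥(maximalRealSubfield L)) L (IsCMField.complexConj L) 3).IsAutomorphicMeasure μ]
      (𝔓 : (quasiSplit (↥(maximalRealSubfield L)) L (IsCMField.complexConj L) 3).ParabolicUnipotentData)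
      (_ : ∀ j : 𝔓.ι, 𝔓.radical j = adelicUnipotent (↥(maximalRealSubfield L)) L (IsCMField.complexConj L) 3)
      (μω : HeckeCharacter L) (hμu : μω.IsUnitary),
      (∀ x : Literature.NumberTheory.GaloisRepresentations.ideleGroup ↥(maximalRealSubfield L),
        μω (AdeleRing.ideleBaseChange (↥(maximalRealSubfield L)) L x) = quadraticHeckeCharCM L x) →
      ∀ (ξ : OneDimAutRepH L), LHalfNeZero (ξ.bcη⁻¹ * μω) →
        ∃ P : DiscreteAutomorphicRep (quasiSplit (↥(maximalRealSubfield L)) L (IsCMField.complexConj L) 3) μ,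
          (∃ Pv : ∀ v : HeightOneSpectrum (𝓞 ↥(maximalRealSubfield L)), CMLocalAPacket L ((StdForm.antidiagonal 3).over L) v,
            ξ.IsXiLocalFamily (UnitaryGroup.cmConj_antidiagonal_transpose L 3)
                ((Matrix.isUnit_iff_isUnit_det _).mp (StdForm.isUnit_over (StdForm.antidiagonal 3) L)) μω hμu Pv ∧
            LocalConstituentsIn P Pv ∧
            ∀ v : HeightOneSpectrum (𝓞 ↥(maximalRealSubfield L)),
              (∀ w : PlacesOver L v, IsCMField.complexConj L • w.1 = w.1) →
              ∀ c : IrrClass ((quasiSplit (↥(maximalRealSubfield L)) L (IsCMField.complexConj L) 3).Local v), c ∈ (Pv v).members →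
                ¬ c.IsSupercuspidal ∧
                ∀ [MeasurableSpace ((quasiSplit (↥(maximalRealSubfield L)) L (IsCMField.complexConj L) 3).Local v ⧸
                      Subgroup.center ((quasiSplit (↥(maximalRealSubfield L)) L (IsCMField.complexConj L) 3).Local v))]
                  [BorelSpace ((quasiSplit (↥(maximalRealSubfield L)) L (IsCMField.complexConj L) 3).Local v ⧸
                      Subgroup.center ((quasiSplit (↥(maximalRealSubfield L)) L (IsCMField.complexConj L) 3).Local v))]
                  (μZ : Measure ((quasiSplit (↥(maximalRealSubfield L)) L (IsCMField.complexConj L) 3).Local v ⧸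
                      Subgroup.center ((quasiSplit (↥(maximalRealSubfield L)) L (IsCMField.complexConj L) 3).Local v)))
                  [μZ.IsHaarMeasure], ¬ c.IsSquareIntegrable μZ) ∧
          P.space ≤ residualSubspace (quasiSplit (↥(maximalRealSubfield L)) L (IsCMField.complexConj L) 3) μ 𝔓) :
    ∀ (L : Type) [Field L] [NumberField L] [IsCMField L]
      (μ : Measure (UnitaryGroup.cmDatum L 3 (qsForm L)).automorphicQuotient) [(UnitaryGroup.cmDatum L 3 (qsForm L)).IsAutomorphicMeasure μ]
      (μω : HeckeCharacter L) (hμu : μω.IsUnitary),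
      (∀ x : Literature.NumberTheory.GaloisRepresentations.ideleGroup ↥(maximalRealSubfield L),
        μω (AdeleRing.ideleBaseChange (↥(maximalRealSubfield L)) L x) = quadraticHeckeCharCM L x) →
      ∀ (ξ : OneDimAutRepH L), LHalfNeZero (ξ.bcη⁻¹ * μω) →
        ∃ P : DiscreteAutomorphicRep (UnitaryGroup.cmDatum L 3 (qsForm L)) μ, IsPiN P μω hμu ξ ∧ P.space ≤ cmResidualSubspaceR L 3 μ := by
  intro L _ _ _ μ _ μω hμu hμω ξ hL
  haveI : (adelicGroupData (↥(maximalRealSubfield L)) L (IsCMField.complexConj L) 3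
      (Matrix.of fun i j : Fin 3 => if i.val + j.val + 1 = 3 then (1 : L) else 0)).IsAutomorphicMeasure μ :=
    ‹(UnitaryGroup.cmDatum L 3 (qsForm L)).IsAutomorphicMeasure μ›
  have hrad : ∀ j : (cmParabolicDataR L 3).ι, (cmParabolicDataR L 3).radical j =
      (flagUnipotentRadical 3 1 (AdeleRing (𝓞 L) L)).comap
        (adelicVal (↥(maximalRealSubfield L)) L (IsCMField.complexConj L) 3 (Matrix.of fun i j : Fin 3 => if i.val + j.val + 1 = 3 then (1 : L) else 0)) := by
    rintro ⟨k, hk1, hk2⟩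
    have hk : k = 1 := by omega
    subst hk
    rfl
  exact resG_piN_occurs_of_eq (H L) (antidiagOne_eq_over L 3).symm (antidiagOne_isHermitian L 3) (isUnit_antidiagOne_det L 3) μ
    (cmParabolicDataR L 3) hrad μω hμu hμω ξ hL

/-! ## §3 Socket #2♯ `sock_S8_res_classification_sharp` — the print-STRENGTH classification with the central-value clause [§13.9 p. 229 (i)–(ii)] -/

/-- **Step 1 of the seam for #2♯** (`J`-generic): §1's classification WITH the clause `L(½, ξ.bcη⁻¹·μω) ≠ 0` (★ `LHalfNeZero`) in the second disjunct, transported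
from Mok's `quasiSplit L⁺ L c 3` to `U(J)` for any `J` with `(antidiagonal 3).over L = J` (same device as §1).
[cite: Rogawski1990, §13.9 p. 229 (i)–(ii)] [cite: MoeglinWaldspurger1995, V.3.13] -/
theorem resG_classification_sharp_of_eq {L : Type} [Field L] [NumberField L] [IsCMField L]
    (H : ∀ (μ : Measure (quasiSplit (↥(maximalRealSubfield L)) L (IsCMField.complexConj L) 3).automorphicQuotient)
      [(quasiSplit (↥(maximalRealSubfield L)) L (IsCMField.complexConj L) 3).IsAutomorphicMeasure μ]
      (𝔓 : (quasiSplit (↥(maximalRealSubfield L)) L (IsCMField.complexConj L) 3).ParabolicUnipotentData)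
      (_ : ∀ j : 𝔓.ι, 𝔓.radical j = adelicUnipotent (↥(maximalRealSubfield L)) L (IsCMField.complexConj L) 3)
      (μω : HeckeCharacter L) (hμu : μω.IsUnitary),
      (∀ x : Literature.NumberTheory.GaloisRepresentations.ideleGroup ↥(maximalRealSubfield L),
        μω (AdeleRing.ideleBaseChange (↥(maximalRealSubfield L)) L x) = quadraticHeckeCharCM L x) →
      ∀ (P : DiscreteAutomorphicRep (quasiSplit (↥(maximalRealSubfield L)) L (IsCMField.complexConj L) 3) μ),
        P.space ≤ residualSubspace (quasiSplit (↥(maximalRealSubfield L)) L (IsCMField.complexConj L) 3) μ 𝔓 →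
        P.IsOneDimensional ∨ ∃ ξ : OneDimAutRepH L,
          (∃ Pv : ∀ v : HeightOneSpectrum (𝓞 ↥(maximalRealSubfield L)), CMLocalAPacket L ((StdForm.antidiagonal 3).over L) v,
            ξ.IsXiLocalFamily (UnitaryGroup.cmConj_antidiagonal_transpose L 3)
                ((Matrix.isUnit_iff_isUnit_det _).mp (StdForm.isUnit_over (StdForm.antidiagonal 3) L)) μω hμu Pv ∧
            LocalConstituentsIn P Pv ∧
            ∀ v : HeightOneSpectrum (𝓞 ↥(maximalRealSubfield L)),
              (∀ w : PlacesOver L v, IsCMField.complexConj L • w.1 = w.1) →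
              ∀ c : IrrClass ((quasiSplit (↥(maximalRealSubfield L)) L (IsCMField.complexConj L) 3).Local v), c ∈ (Pv v).members →
                ¬ c.IsSupercuspidal ∧
                ∀ [MeasurableSpace ((quasiSplit (↥(maximalRealSubfield L)) L (IsCMField.complexConj L) 3).Local v ⧸
                      Subgroup.center ((quasiSplit (↥(maximalRealSubfield L)) L (IsCMField.complexConj L) 3).Local v))]
                  [BorelSpace ((quasiSplit (↥(maximalRealSubfield L)) L (IsCMField.complexConj L) 3).Local v ⧸
                      Subgroup.center ((quasiSplit (↥(maximalRealSubfield L)) L (IsCMField.complexConj L) 3).Local v))]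
                  (μZ : Measure ((quasiSplit (↥(maximalRealSubfield L)) L (IsCMField.complexConj L) 3).Local v ⧸
                      Subgroup.center ((quasiSplit (↥(maximalRealSubfield L)) L (IsCMField.complexConj L) 3).Local v)))
                  [μZ.IsHaarMeasure], ¬ c.IsSquareIntegrable μZ) ∧
          LHalfNeZero (ξ.bcη⁻¹ * μω))
    {J : Matrix (Fin 3) (Fin 3) L} (hJ : (StdForm.antidiagonal 3).over L = J) (hJh : (J.map (cmConjRingHom L))ᵀ = J) (hJu : IsUnit J.det)
    (μ : Measure (adelicGroupData (↥(maximalRealSubfield L)) L (IsCMField.complexConj L) 3 J).automorphicQuotient)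
    [(adelicGroupData (↥(maximalRealSubfield L)) L (IsCMField.complexConj L) 3 J).IsAutomorphicMeasure μ]
    (𝔓 : (adelicGroupData (↥(maximalRealSubfield L)) L (IsCMField.complexConj L) 3 J).ParabolicUnipotentData)
    (h𝔓 : ∀ j : 𝔓.ι, 𝔓.radical j =
      (flagUnipotentRadical 3 1 (AdeleRing (𝓞 L) L)).comap (adelicVal (↥(maximalRealSubfield L)) L (IsCMField.complexConj L) 3 J))
    (μω : HeckeCharacter L) (hμu : μω.IsUnitary)
    (hμω : ∀ x : Literature.NumberTheory.GaloisRepresentations.ideleGroup ↥(maximalRealSubfield L),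
      μω (AdeleRing.ideleBaseChange (↥(maximalRealSubfield L)) L x) = quadraticHeckeCharCM L x)
    (P : DiscreteAutomorphicRep (adelicGroupData (↥(maximalRealSubfield L)) L (IsCMField.complexConj L) 3 J) μ)
    (hP : P.space ≤ residualSubspace (adelicGroupData (↥(maximalRealSubfield L)) L (IsCMField.complexConj L) 3 J) μ 𝔓) :
    P.IsOneDimensional ∨ ∃ ξ : OneDimAutRepH L,
      (∃ Pv : ∀ v : HeightOneSpectrum (𝓞 ↥(maximalRealSubfield L)), CMLocalAPacket L J v,
        ξ.IsXiLocalFamily hJh hJu μω hμu Pv ∧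
        LocalConstituentsIn P Pv ∧
        ∀ v : HeightOneSpectrum (𝓞 ↥(maximalRealSubfield L)),
          (∀ w : PlacesOver L v, IsCMField.complexConj L • w.1 = w.1) →
          ∀ c : IrrClass ((UnitaryGroup.cmDatum L 3 J).Local v), c ∈ (Pv v).members →
            ¬ c.IsSupercuspidal ∧
            ∀ [MeasurableSpace ((UnitaryGroup.cmDatum L 3 J).Local v ⧸ Subgroup.center ((UnitaryGroup.cmDatum L 3 J).Local v))]
              [BorelSpace ((UnitaryGroup.cmDatum L 3 J).Local v ⧸ Subgroup.center ((UnitaryGroup.cmDatum L 3 J).Local v))]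
              (μZ : Measure ((UnitaryGroup.cmDatum L 3 J).Local v ⧸ Subgroup.center ((UnitaryGroup.cmDatum L 3 J).Local v)))
              [μZ.IsHaarMeasure], ¬ c.IsSquareIntegrable μZ) ∧
      LHalfNeZero (ξ.bcη⁻¹ * μω) := by
  subst hJ
  have h𝔓' : ∀ j : 𝔓.ι, 𝔓.radical j = adelicUnipotent (↥(maximalRealSubfield L)) L (IsCMField.complexConj L) 3 := fun j => by
    rw [h𝔓 j]
    show _ = (upperUnitriangular (Fin 3) (AdeleRing (𝓞 L) L)).comap _
    rw [upperUnitriangular_eq_flagUnipotentRadical_three]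
  exact H μ 𝔓 h𝔓' μω hμu hμω P hP

/-- **THE JUNCTION for #2♯ — the quasiSplit sharp classification for every CM field yields socket #2♯'s EXACT type** (B ED. 4 :433–:442: literal `Φ₃`, `IsPiN`,
`LHalfNeZero (ξ.bcη⁻¹ * μω)`).  B ED. 5 pays #2♯ by `exact resG_classification_sharp_of_quasiSplit ‹that›` (then #2 by ★ `res_classification_of_sharp`). [cite: Rogawski1990, §13.9 p. 229 (i)–(ii)] -/
theorem resG_classification_sharp_of_quasiSplit
    (H : ∀ (L : Type) [Field L] [NumberField L] [IsCMField L]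
      (μ : Measure (quasiSplit (↥(maximalRealSubfield L)) L (IsCMField.complexConj L) 3).automorphicQuotient)
      [(quasiSplit (↥(maximalRealSubfield L)) L (IsCMField.complexConj L) 3).IsAutomorphicMeasure μ]
      (𝔓 : (quasiSplit (↥(maximalRealSubfield L)) L (IsCMField.complexConj L) 3).ParabolicUnipotentData)
      (_ : ∀ j : 𝔓.ι, 𝔓.radical j = adelicUnipotent (↥(maximalRealSubfield L)) L (IsCMField.complexConj L) 3)
      (μω : HeckeCharacter L) (hμu : μω.IsUnitary),
      (∀ x : Literature.NumberTheory.GaloisRepresentations.ideleGroup ↥(maximalRealSubfield L),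
        μω (AdeleRing.ideleBaseChange (↥(maximalRealSubfield L)) L x) = quadraticHeckeCharCM L x) →
      ∀ (P : DiscreteAutomorphicRep (quasiSplit (↥(maximalRealSubfield L)) L (IsCMField.complexConj L) 3) μ),
        P.space ≤ residualSubspace (quasiSplit (↥(maximalRealSubfield L)) L (IsCMField.complexConj L) 3) μ 𝔓 →
        P.IsOneDimensional ∨ ∃ ξ : OneDimAutRepH L,
          (∃ Pv : ∀ v : HeightOneSpectrum (𝓞 ↥(maximalRealSubfield L)), CMLocalAPacket L ((StdForm.antidiagonal 3).over L) v,
            ξ.IsXiLocalFamily (UnitaryGroup.cmConj_antidiagonal_transpose L 3)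
                ((Matrix.isUnit_iff_isUnit_det _).mp (StdForm.isUnit_over (StdForm.antidiagonal 3) L)) μω hμu Pv ∧
            LocalConstituentsIn P Pv ∧
            ∀ v : HeightOneSpectrum (𝓞 ↥(maximalRealSubfield L)),
              (∀ w : PlacesOver L v, IsCMField.complexConj L • w.1 = w.1) →
              ∀ c : IrrClass ((quasiSplit (↥(maximalRealSubfield L)) L (IsCMField.complexConj L) 3).Local v), c ∈ (Pv v).members →
                ¬ c.IsSupercuspidal ∧
                ∀ [MeasurableSpace ((quasiSplit (↥(maximalRealSubfield L)) L (IsCMField.complexConj L) 3).Local v ⧸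
                      Subgroup.center ((quasiSplit (↥(maximalRealSubfield L)) L (IsCMField.complexConj L) 3).Local v))]
                  [BorelSpace ((quasiSplit (↥(maximalRealSubfield L)) L (IsCMField.complexConj L) 3).Local v ⧸
                      Subgroup.center ((quasiSplit (↥(maximalRealSubfield L)) L (IsCMField.complexConj L) 3).Local v))]
                  (μZ : Measure ((quasiSplit (↥(maximalRealSubfield L)) L (IsCMField.complexConj L) 3).Local v ⧸
                      Subgroup.center ((quasiSplit (↥(maximalRealSubfield L)) L (IsCMField.complexConj L) 3).Local v)))
                  [μZ.IsHaarMeasure], ¬ c.IsSquareIntegrable μZ) ∧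
          LHalfNeZero (ξ.bcη⁻¹ * μω)) :
    ∀ (L : Type) [Field L] [NumberField L] [IsCMField L]
      (μ : Measure (UnitaryGroup.cmDatum L 3 (qsForm L)).automorphicQuotient) [(UnitaryGroup.cmDatum L 3 (qsForm L)).IsAutomorphicMeasure μ]
      (μω : HeckeCharacter L) (hμu : μω.IsUnitary),
      (∀ x : Literature.NumberTheory.GaloisRepresentations.ideleGroup ↥(maximalRealSubfield L),
        μω (AdeleRing.ideleBaseChange (↥(maximalRealSubfield L)) L x) = quadraticHeckeCharCM L x) →
      ∀ (P : DiscreteAutomorphicRep (UnitaryGroup.cmDatum L 3 (qsForm L)) μ),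
        P.space ≤ cmResidualSubspaceR L 3 μ →
        P.IsOneDimensional ∨ ∃ ξ : OneDimAutRepH L, IsPiN P μω hμu ξ ∧ LHalfNeZero (ξ.bcη⁻¹ * μω) := by
  intro L _ _ _ μ _ μω hμu hμω P hP
  haveI : (adelicGroupData (↥(maximalRealSubfield L)) L (IsCMField.complexConj L) 3
      (Matrix.of fun i j : Fin 3 => if i.val + j.val + 1 = 3 then (1 : L) else 0)).IsAutomorphicMeasure μ :=
    ‹(UnitaryGroup.cmDatum L 3 (qsForm L)).IsAutomorphicMeasure μ›
  have hrad : ∀ j : (cmParabolicDataR L 3).ι, (cmParabolicDataR L 3).radical j =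
      (flagUnipotentRadical 3 1 (AdeleRing (𝓞 L) L)).comap
        (adelicVal (↥(maximalRealSubfield L)) L (IsCMField.complexConj L) 3 (Matrix.of fun i j : Fin 3 => if i.val + j.val + 1 = 3 then (1 : L) else 0)) := by
    rintro ⟨k, hk1, hk2⟩
    have hk : k = 1 := by omega
    subst hk
    rfl
  exact resG_classification_sharp_of_eq (H L) (antidiagOne_eq_over L 3).symm (antidiagOne_isHermitian L 3) (isUnit_antidiagOne_det L 3) μ
    (cmParabolicDataR L 3) hrad μω hμu hμω P hP

end Summit.HodgeConjecture.HodgeConjecture.R90.S8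
end
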